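import Mathlib
import Literature.NumberTheory.Transcendental.MZVSimplexRep
import Literature.NumberTheory.Transcendental.KZIdealTetrahedron
import Literature.Analysis.FunctionSpaces.SteinHardy

/-!
# Stub `stub_separateZero` (crux `ArrangementNormalForm`, line `janus-bands`) — part `Tools`

Generic real-analysis tools for the FIBRE-MASS theorem behind `stub_separateZero` (line `janus-bands`,
crux `ArrangementNormalForm`): the key power-counting inequality on a gap simplex (after Zagier /
Brown: pile the excess exponents onto the minimal coordinate), weighted AM–GM, the one-variable
majorant `ω_c(u) = 2(u^{-c} + (1-u)^{-c})` and its integral `K_c < ∞` transported to a gap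
`(V, W)`, interval integrability of `|x|^r` (`r > -1`) and of `|αy+β|^{-θ}`, and local
integrability of the base majorant `(1 + ∑ₚ |αₚ y + βₚ|^{-θ})^n` for `nθ < 1` (Jensen).

References: M. Kontsevich, D. Zagier, *Periods* (2001), §1.2; D. Zagier, *Values of zeta functions
and their applications* (1994), §9; F. Brown, *Mixed Tate motives over ℤ* (2012), §1.
-/

noncomputable section

open Set MeasureTheory
open Literature.NumberTheory.Transcendental
open scoped ENNReal

namespace Summit.KontsevichZagierPeriods.ArrangementNormalForm.JanusBands

namespace SepZero

/-! ### Power counting -/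

/-- **Key inequality** (gap-simplex power counting). For `0 < uᵢ ≤ 1` on `G`, minimal at `b ∈ G`,
exponents `e i ∈ [0, 1]` with `(∑_{i ≠ b} e i)(1 - c) + e b ≤ c ≤ 1`:
`∏_{i ∈ G} uᵢ^{-eᵢ} ≤ ∏_{i ∈ G} uᵢ^{-c}`. -/
theorem key_ineq {ι : Type*} [DecidableEq ι] (G : Finset ι) (u e : ι → ℝ) (b : ι) (hb : b ∈ G)
    (hu0 : ∀ i ∈ G, 0 < u i) (hu1 : ∀ i ∈ G, u i ≤ 1) (hmin : ∀ i ∈ G, u b ≤ u i)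
    (he0 : ∀ i ∈ G, 0 ≤ e i) (he1 : ∀ i ∈ G, e i ≤ 1) {c : ℝ} (hc1 : c ≤ 1)
    (hc : (∑ i ∈ G.erase b, e i) * (1 - c) + e b ≤ c) :
    ∏ i ∈ G, u i ^ (-e i) ≤ ∏ i ∈ G, u i ^ (-c) := by
  have hbpos := hu0 b hb
  have hsum0 : 0 ≤ ∑ i ∈ G.erase b, e i :=
    Finset.sum_nonneg fun i hi => he0 i (Finset.mem_of_mem_erase hi)
  have hc0 : 0 ≤ c := le_trans (by nlinarith [he0 b hb]) hc
  -- each non-minimal factor: u_i^{-e_i} ≤ u_i^{-c} * u_b^{-(1-c) e_i}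
  have hfac : ∀ i ∈ G.erase b, u i ^ (-e i) ≤ u i ^ (-c) * u b ^ (-((1 - c) * e i)) := by
    intro i hi
    have hiG := Finset.mem_of_mem_erase hi
    have h1 : u i ^ (-e i) = u i ^ (-(c * e i)) * u i ^ (-((1 - c) * e i)) := by
      rw [← Real.rpow_add (hu0 i hiG)]; congr 1; ring
    rw [h1]
    refine mul_le_mul ?_ ?_ (Real.rpow_nonneg (hu0 i hiG).le _) (Real.rpow_nonneg (hu0 i hiG).le _)
    · exact Real.rpow_le_rpow_of_exponent_ge (hu0 i hiG) (hu1 i hiG)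
        (by nlinarith [he1 i hiG, hc0])
    · exact Real.rpow_le_rpow_of_nonpos (hu0 b hb) (hmin i hiG)
        (by nlinarith [he0 i hiG, hc1])
  rw [← Finset.mul_prod_erase _ _ hb, ← Finset.mul_prod_erase _ _ hb]
  have hprod : ∏ i ∈ G.erase b, u i ^ (-e i) ≤
      (∏ i ∈ G.erase b, u i ^ (-c)) * u b ^ (-((1 - c) * ∑ i ∈ G.erase b, e i)) := by
    calc ∏ i ∈ G.erase b, u i ^ (-e i)
        ≤ ∏ i ∈ G.erase b, (u i ^ (-c) * u b ^ (-((1 - c) * e i))) :=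
          Finset.prod_le_prod (fun i hi => Real.rpow_nonneg (hu0 i (Finset.mem_of_mem_erase hi)).le _)
            hfac
      _ = (∏ i ∈ G.erase b, u i ^ (-c)) * ∏ i ∈ G.erase b, u b ^ (-((1 - c) * e i)) :=
          Finset.prod_mul_distrib
      _ = (∏ i ∈ G.erase b, u i ^ (-c)) * u b ^ (-((1 - c) * ∑ i ∈ G.erase b, e i)) := by
          congr 1
          rw [Finset.mul_sum, neg_eq_neg_one_mul, Finset.mul_sum, Real.rpow_sum_of_pos hbpos]
          refine Finset.prod_congr rfl fun i _ => ?_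
          congr 1; ring
  have hA : 0 ≤ ∏ i ∈ G.erase b, u i ^ (-c) :=
    Finset.prod_nonneg fun i hi => Real.rpow_nonneg (hu0 i (Finset.mem_of_mem_erase hi)).le _
  calc u b ^ (-e b) * ∏ i ∈ G.erase b, u i ^ (-e i)
      ≤ u b ^ (-e b) * ((∏ i ∈ G.erase b, u i ^ (-c)) *
          u b ^ (-((1 - c) * ∑ i ∈ G.erase b, e i))) :=
        mul_le_mul_of_nonneg_left hprod (Real.rpow_nonneg hbpos.le _)
    _ = u b ^ (-e b + -((1 - c) * ∑ i ∈ G.erase b, e i)) * ∏ i ∈ G.erase b, u i ^ (-c) := by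
        rw [Real.rpow_add hbpos]; ring
    _ ≤ u b ^ (-c) * ∏ i ∈ G.erase b, u i ^ (-c) := by
        refine mul_le_mul_of_nonneg_right ?_ hA
        exact Real.rpow_le_rpow_of_exponent_ge hbpos (hu1 b hb) (by nlinarith)

/-- Weighted AM–GM in the form `(p + q)⁻¹ ≤ p^{-(1-θ)} q^{-θ}` for `p, q > 0`, `θ ∈ [0,1]`. -/
theorem inv_add_le_rpow {p q θ : ℝ} (hp : 0 < p) (hq : 0 < q) (h0 : 0 ≤ θ) (h1 : θ ≤ 1) :
    (p + q)⁻¹ ≤ p ^ (-(1 - θ)) * q ^ (-θ) := by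
  have hgm : p ^ (1 - θ) * q ^ θ ≤ (1 - θ) * p + θ * q :=
    Real.geom_mean_le_arith_mean2_weighted (by linarith) h0 hp.le hq.le (by ring)
  have hle : p ^ (1 - θ) * q ^ θ ≤ p + q := by nlinarith
  have hpos : 0 < p ^ (1 - θ) * q ^ θ := mul_pos (Real.rpow_pos_of_pos hp _) (Real.rpow_pos_of_pos hq _)
  rw [Real.rpow_neg hp.le, Real.rpow_neg hq.le, ← mul_inv]
  exact inv_anti₀ hpos hle

/-- `1 / x ^ n ≤ 1 / x ^ m + 1` for naturals `n ≤ m` and `x ≥ 0`. -/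
theorem one_div_pow_le_of_le {x : ℝ} (hx : 0 ≤ x) {n m : ℕ} (h : n ≤ m) :
    1 / x ^ n ≤ 1 / x ^ m + 1 := by
  have hm0 : (0:ℝ) ≤ 1 / x ^ m := by positivity
  rcases le_or_gt x 1 with hx1 | hx1
  · rcases eq_or_lt_of_le hx with rfl | hx0
    · rcases Nat.eq_zero_or_pos n with rfl | hn
      · simp only [pow_zero, div_one]
        linarith
      · simp [zero_pow (Nat.pos_iff_ne_zero.mp hn)]
        positivity
    have : x ^ m ≤ x ^ n := pow_le_pow_of_le_one hx hx1 h
    have h2 : 1 / x ^ n ≤ 1 / x ^ m := one_div_le_one_div_of_le (pow_pos hx0 m) this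
    linarith
  · have : 1 / x ^ n ≤ 1 := by
      rw [div_le_one (pow_pos (by linarith) n)]
      exact one_le_pow₀ hx1.le
    linarith

/-! ### One-variable integrals -/

/-- The one-variable majorant `ω_c(u) = 2 (u^{-c} + (1-u)^{-c})`. -/
def omg (c u : ℝ) : ℝ := 2 * (u ^ (-c) + (1 - u) ^ (-c))

/-- `ω_c` is nonnegative. -/
theorem omg_nonneg (c : ℝ) {u : ℝ} (h0 : 0 ≤ u) (h1 : u ≤ 1) : 0 ≤ omg c u := by
  unfold omg
  have := Real.rpow_nonneg h0 (-c)
  have := Real.rpow_nonneg (sub_nonneg.2 h1) (-c)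
  positivity

/-- The constant `K_c = ∫₀¹ ω_c`. -/
def Kc (c : ℝ) : ℝ≥0∞ := ∫⁻ u in Ioo (0:ℝ) 1, ENNReal.ofReal (omg c u)

/-- `K_c < ∞` for `c < 1` (two Beta integrals). -/
theorem Kc_lt_top {c : ℝ} (hc : c < 1) : Kc c < ⊤ := by
  have h := (KZ.integrableOn_Ioo_majorant hc).2
  rw [hasFiniteIntegral_iff_enorm] at h
  exact lt_of_le_of_lt (lintegral_ofReal_le_lintegral_enorm _) h

/-- The transported majorant on a gap `(V, W)`: `ω_c((t-V)/(W-V))/(W-V)` on `(V, W)`, else `0`. -/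
def psi (c V W t : ℝ) : ℝ≥0∞ :=
  (Ioo V W).indicator (fun t => ENNReal.ofReal (omg c ((t - V) / (W - V)) / (W - V))) t

/-- `∫ ψ ≤ K_c` (equality if `V < W`, zero otherwise). -/
theorem lintegral_psi_le (c V W : ℝ) : ∫⁻ t, psi c V W t ≤ Kc c := by
  rcases le_or_gt W V with hWV | hVW
  · simp [psi, Ioo_eq_empty_of_le hWV]
  set Δ := W - V with hΔ
  have hΔ0 : 0 < Δ := sub_pos.2 hVW
  set G : ℝ → ℝ≥0∞ := (Ioo (0:ℝ) 1).indicator fun u => ENNReal.ofReal (omg c u) with hG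
  have hpsi : ∀ t, psi c V W t = ENNReal.ofReal Δ⁻¹ * G (Δ⁻¹ * t + -(V / Δ)) := by
    intro t
    have hu : Δ⁻¹ * t + -(V / Δ) = (t - V) / Δ := by field_simp; ring
    rw [hu]
    by_cases ht : t ∈ Ioo V W
    · have hu' : (t - V) / Δ ∈ Ioo (0:ℝ) 1 := by
        constructor
        · exact div_pos (sub_pos.2 ht.1) hΔ0
        · rw [div_lt_one hΔ0]; linarith [ht.2]
      rw [psi, indicator_of_mem ht, hG, indicator_of_mem hu', div_eq_inv_mul,
        ENNReal.ofReal_mul (inv_nonneg.2 hΔ0.le)]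
    · have hu' : (t - V) / Δ ∉ Ioo (0:ℝ) 1 := by
        intro h
        apply ht
        constructor
        · have := h.1; rw [lt_div_iff₀ hΔ0] at this; linarith
        · have := h.2; rw [div_lt_iff₀ hΔ0] at this; linarith
      rw [psi, indicator_of_notMem ht, hG, indicator_of_notMem hu', mul_zero]
  simp_rw [hpsi]
  rw [lintegral_const_mul' _ _ ENNReal.ofReal_ne_top,
    Literature.Analysis.FunctionSpaces.lintegral_comp_mul_add G (inv_ne_zero hΔ0.ne') _, inv_inv, abs_of_pos hΔ0, ← mul_assoc,
    ← ENNReal.ofReal_mul (inv_nonneg.2 hΔ0.le), inv_mul_cancel₀ hΔ0.ne', ENNReal.ofReal_one,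
    one_mul, hG, lintegral_indicator measurableSet_Ioo]
  exact le_rfl

/-- `∫_{[-L,L]} |α y + β|^{-θ} dy < ∞` for `0 ≤ θ < 1`. -/
theorem lintegral_abs_affine_rpow_lt_top (α β L θ : ℝ) (hθ : θ < 1) :
    ∫⁻ y in Icc (-L) L, ENNReal.ofReal (|α * y + β| ^ (-θ)) < ⊤ := by
  rcases lt_or_ge L 0 with hL | hL
  · rw [Icc_eq_empty (by linarith), Measure.restrict_empty, lintegral_zero_measure]
    exact ENNReal.zero_lt_top
  have hfin : IntegrableOn (fun y : ℝ => |α * y + β| ^ (-θ)) (Icc (-L) L) := by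
    rcases eq_or_ne α 0 with rfl | hα
    · simp only [zero_mul, zero_add]
      exact integrableOn_const (by rw [Real.volume_Icc]; exact ENNReal.ofReal_ne_top)
    · have h1 : IntervalIntegrable (fun y : ℝ => |y| ^ (-θ)) volume (-L + β / α) (L + β / α) :=
        KZ.UpperHalfSpace.intervalIntegrable_abs_rpow (by linarith) _ _
      have h2 := h1.comp_add_right (β / α)
      simp only [add_sub_cancel_right] at h2
      have h3 := (h2.const_mul (|α| ^ (-θ)))
      rw [intervalIntegrable_iff_integrableOn_Icc_of_le (by linarith)] at h3
      refine h3.congr_fun (fun y _ => ?_) measurableSet_Icc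
      show |α| ^ (-θ) * |y + β / α| ^ (-θ) = _
      rw [← Real.mul_rpow (abs_nonneg _) (abs_nonneg _), ← abs_mul]
      congr 2
      field_simp
  have h := hfin.2
  rw [hasFiniteIntegral_iff_enorm] at h
  exact lt_of_le_of_lt (lintegral_ofReal_le_lintegral_enorm _) h

/-- Local integrability of the base majorant `(1 + ∑ₚ |αₚ y + βₚ|^{-θ})^n` when `n θ < 1`. -/
theorem lintegral_base_majorant_lt_top {ι : Type*} (T : Finset ι) (α β : ι → ℝ) (L θ : ℝ)
    (n : ℕ) (hθ : θ * n < 1) :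
    ∫⁻ y in Icc (-L) L, ENNReal.ofReal ((1 + ∑ p ∈ T, |α p * y + β p| ^ (-θ)) ^ n) < ⊤ := by
  classical
  rcases Nat.eq_zero_or_pos n with rfl | hn
  · simp only [pow_zero, ENNReal.ofReal_one, setLIntegral_const, one_mul, Real.volume_Icc]
    exact ENNReal.ofReal_lt_top
  obtain ⟨n, rfl⟩ : ∃ m, n = m + 1 := ⟨n - 1, by omega⟩
  -- pointwise Jensen: (1 + ∑ f)^{n+1} ≤ (|T|+1)^n (1 + ∑ f^{n+1})
  set N : ℝ := ((insert none (T.image some)).card : ℝ) with hN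
  have hpt : ∀ y : ℝ, (1 + ∑ p ∈ T, |α p * y + β p| ^ (-θ)) ^ (n + 1) ≤
      N ^ n * (1 + ∑ p ∈ T, |α p * y + β p| ^ (-(θ * (n + 1 : ℕ)))) := by
    intro y
    set g : Option ι → ℝ := fun o => o.elim 1 (fun p => |α p * y + β p| ^ (-θ)) with hg
    have hg0 : ∀ o ∈ insert none (T.image some), 0 ≤ g o := by
      intro o _; cases o with
      | none => exact zero_le_one
      | some p => exact Real.rpow_nonneg (abs_nonneg _) _
    have hsum : ∑ o ∈ insert none (T.image some), g o ^ (n + 1) =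
        1 + ∑ p ∈ T, (|α p * y + β p| ^ (-θ)) ^ (n + 1) := by
      rw [Finset.sum_insert (by simp), Finset.sum_image (by simp)]
      simp [hg]
    have hsum' : ∑ o ∈ insert none (T.image some), g o = 1 + ∑ p ∈ T, |α p * y + β p| ^ (-θ) := by
      rw [Finset.sum_insert (by simp), Finset.sum_image (by simp)]
      simp [hg]
    have key := pow_sum_le_card_mul_sum_pow hg0 n
    rw [hsum, hsum'] at key
    refine key.trans (le_of_eq ?_)
    congr 2
    refine Finset.sum_congr rfl fun p _ => ?_
    rw [← Real.rpow_mul_natCast (abs_nonneg _)]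
    congr 1; push_cast; ring
  have hmeas : ∀ (s : ℝ) (p : ι), Measurable fun y : ℝ => |α p * y + β p| ^ s := fun s p =>
    ((measurable_const.mul measurable_id).add_const _).abs.pow_const _
  calc ∫⁻ y in Icc (-L) L, ENNReal.ofReal ((1 + ∑ p ∈ T, |α p * y + β p| ^ (-θ)) ^ (n + 1))
      ≤ ∫⁻ y in Icc (-L) L, ENNReal.ofReal (N ^ n) *
          (1 + ∑ p ∈ T, ENNReal.ofReal (|α p * y + β p| ^ (-(θ * (n + 1 : ℕ))))) := by
        refine lintegral_mono fun y => ?_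
        refine (ENNReal.ofReal_le_ofReal (hpt y)).trans (le_of_eq ?_)
        rw [ENNReal.ofReal_mul (by positivity), ENNReal.ofReal_add zero_le_one
          (Finset.sum_nonneg fun p _ => Real.rpow_nonneg (abs_nonneg _) _), ENNReal.ofReal_one,
          ENNReal.ofReal_sum_of_nonneg fun p _ => Real.rpow_nonneg (abs_nonneg _) _]
    _ = ENNReal.ofReal (N ^ n) * (volume (Icc (-L) L) +
          ∑ p ∈ T, ∫⁻ y in Icc (-L) L, ENNReal.ofReal (|α p * y + β p| ^ (-(θ * (n + 1 : ℕ))))) := by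
        have hm : Measurable fun y : ℝ =>
            (1 : ℝ≥0∞) + ∑ p ∈ T, ENNReal.ofReal (|α p * y + β p| ^ (-(θ * (n + 1 : ℕ)))) :=
          measurable_const.add (Finset.measurable_sum _ fun p _ => (hmeas _ p).ennreal_ofReal)
        rw [lintegral_const_mul _ hm, lintegral_add_left measurable_const,
          lintegral_finsetSum _ fun p _ => (hmeas _ p).ennreal_ofReal]
        simp
    _ < ⊤ := by
        refine ENNReal.mul_lt_top ENNReal.ofReal_lt_top (ENNReal.add_lt_top.2 ⟨?_, ?_⟩)
        · rw [Real.volume_Icc]; exact ENNReal.ofReal_lt_top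
        · refine ENNReal.sum_lt_top.2 fun p _ => ?_
          exact lintegral_abs_affine_rpow_lt_top _ _ _ _ (by push_cast at hθ ⊢; linarith)

end SepZero

/-- Registered support goal of this file: the key power-counting inequality on a gap simplex. -/
theorem separateZero_keyIneq (ι : Type) (hι : DecidableEq ι) (G : Finset ι) (u e : ι → ℝ) (b : ι) (hb : b ∈ G) (hu0 : ∀ i ∈ G, 0 < u i) (hu1 : ∀ i ∈ G, u i ≤ 1) (hmin : ∀ i ∈ G, u b ≤ u i) (he0 : ∀ i ∈ G, 0 ≤ e i) (he1 : ∀ i ∈ G, e i ≤ 1) (c : ℝ) (hc1 : c ≤ 1) (hc : (∑ i ∈ G.erase b, e i) * (1 - c) + e b ≤ c) : ∏ i ∈ G, u i ^ (-e i) ≤ ∏ i ∈ G, u i ^ (-c) :=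
  SepZero.key_ineq G u e b hb hu0 hu1 hmin he0 he1 hc1 hc

end Summit.KontsevichZagierPeriods.ArrangementNormalForm.JanusBands
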